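import Summits.BirchSwinnertonDyer.BirchSwinnertonDyer.Theorems.ThetaPartnerAtTwoMazurTateCongruenceAtTwoRFourFacts
import HarnessLib

/-!
# Crux `MazurTateCongruenceAtTwoTop` (stmt-BirchSwinnertonDyer-25797 = `MazurTateCongruenceAtTwoR` 21416), line `symbol`:
# POINTWISE pair closers behind FOUR print facts — the conclusion of the crux at one pair `(W, A)` from
# {ES-depleted, SD, Bz, Se} + the period fact + ONE per-pair research datum (FLAT at the two Pollack pairs | (PR₂) at the two curves |
# `CuspSpanEvenAtTwo` at the two conductors | two unit L-values) (width seat bsd-wall-tp2-p1-w2 g2; `--supports stmt-BirchSwinnertonDyer-25797`)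

HONEST FRAMING. THEOREMS ONLY. The named Literature facts and the per-pair research data are explicit HYPOTHESES; nothing about their truth
is asserted; BSD is not proved by any of this.

WHAT. The four-fact twins of `…RSymbolMuPointwise` §2 / `…RSymbolMuOfFlat` §3 (which display six facts): each is one line over
`mazurTateCongruence_of_plusLine` (`…RFourFacts`, the lead's one-socket assembly re-threaded through the plus line) fed by route
ResidualThetaTransportAtTwo's `plusLineCharTwo_of_fourFacts (hES hSD hBz hSe)` and by the `Hμ(E)` doors `symbolMu_of_flat`,
`symbolMu_of_undepletedMax`, `symbolMu_of_norm_ratPlusSymbol_zero_eq_one`, `symbolMu_of_cuspSpanEvenAtTwo`.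
* `mazurTateCongruence_of_fourFacts_flat` — the «both FLAT ⇒ congruence» half of the lead g11's sharpening «crux ⟺ (FLAT(W) ↔ FLAT(A))
  mod PUB», in four-fact form;
* `mazurTateCongruence_of_fourFacts_undepletedMax`, `…_of_fourFacts_cuspSpanAt`, `…_of_fourFacts_unitLValues` (the unit-zone road: no
  conjecture-grade input).

References: [GreenbergVatsal2000] Thm. (1.4), §3 (13), Remark 3.4; [Vatsal1999] Thm. (1.13); [Pollack2003] Conj. 6.3, Prop. 6.18;
[Buzzard2000LevelLoweringModTwo] Prop. 2.4; [Kurihara2002] Thm. 0.1.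
-/

-- justification: the `Summit.BirchSwinnertonDyer.BirchSwinnertonDyer.…` path repeats a component (route-file convention)
set_option linter.dupNamespace false
set_option autoImplicit false

noncomputable section

open scoped Classical MatrixGroups ModularForm

open CongruenceSubgroup Polynomial WeierstrassCurve NumberField IsDedekindDomain
  Literature.NumberTheory.IwasawaTheory Literature.NumberTheory.EllipticCurves Literature.NumberTheory.EllipticCurves.ModularForms
  Literature.NumberTheory.EllipticCurves.Rank1Residual Literature.NumberTheory.EllipticCurves.GreenbergVatsal2000
  Literature.NumberTheory.EllipticCurves.Sprung2017
  Summit.BirchSwinnertonDyer.Rank1Residual.Supersingular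
  Summit.BirchSwinnertonDyer.BirchSwinnertonDyer.Theorems.ThetaLayerLambdaCongruenceAtTwo

namespace Summit.BirchSwinnertonDyer.BirchSwinnertonDyer.Theorems.MazurTateCongruenceAtTwoR

section Pair

variable (W : WeierstrassCurve ℚ) [W.IsElliptic] [W.IsGloballyMinimal] (A : WeierstrassCurve ℚ) [A.IsElliptic]
  [A.IsGloballyMinimal]

/-- **Both FLAT ⇒ the crux's conclusion at `(W, A)`, behind FOUR print facts + the period fact.** For `W, A` globally minimal, good
supersingular at `2` with `a₂ = 0`, `Δ_W < 0`, a Galois-equivariant `W[2] ≃+ A[2]`, newforms, Néron ratios, Pollack pairs whose flat members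
`kobayashiL 1 · ·` each have a unit coefficient, an admissible `S₀` and integral multiples: the oriented `S₀`-depleted Mazur–Tate congruence holds
at every even layer with `u = 1`. [cite: GreenbergVatsal2000, Thm. (1.4), §3 (13)] [cite: Pollack2003, Conj. 6.3 and Prop. 6.18]
[cite: Buzzard2000LevelLoweringModTwo, Prop. 2.4] -/
theorem mazurTateCongruence_of_fourFacts_flat
    (hES : eichlerShimura_depletedOptimalQuotient_periodLattice_of_dvd) (hSD : heckeSelfDual_torsionBy_J0)
    (hBz : buzzard2000_multiplicityOne_gamma0) (hSe : serre1972_supersingular_decompositionSubgroup_image)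
    (h2 : realPeriodRat_eq_unit_mul_plusPeriod_two)
    (hss : GoodSS W 2) (ha : W.frobeniusTrace 2 = 0) (hΔ : W.Δ < 0) (hssA : GoodSS A 2) (haA : A.frobeniusTrace 2 = 0)
    (he : ∃ e : geomTorsion W (2 : ℤ) ≃+ geomTorsion A (2 : ℤ),
      ∀ (σ : Field.absoluteGaloisGroup ℚ) (P : geomTorsion W (2 : ℤ)), e (σ • P) = σ • e P)
    [NeZero (W.conductorNorm ℤ)] (f : CuspForm (Gamma0 (W.conductorNorm ℤ)) 2) (hf : IsNewformOf W f) {ϖ : ℚ}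
    (hϖ : (ϖ : ℝ) * W.realPeriodRat = plusPeriod f)
    {Lplus Lminus : IwasawaAlgebra 2} (hPP : IsPollackPair f 2 Lplus Lminus)
    (hflatW : ∃ n : ℕ, IsUnit (PowerSeries.coeff n (kobayashiL 1 Lplus Lminus)))
    [NeZero (A.conductorNorm ℤ)] (fA : CuspForm (Gamma0 (A.conductorNorm ℤ)) 2) (hfA : IsNewformOf A fA) {ϖA : ℚ}
    (hϖA : (ϖA : ℝ) * A.realPeriodRat = plusPeriod fA)
    {LplusA LminusA : IwasawaAlgebra 2} (hPPA : IsPollackPair fA 2 LplusA LminusA)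
    (hflatA : ∃ n : ℕ, IsUnit (PowerSeries.coeff n (kobayashiL 1 LplusA LminusA)))
    (S₀ : Finset (HeightOneSpectrum (𝓞 ℚ))) (hS2 : ∀ v ∈ S₀, ((2 : ℕ) : 𝓞 ℚ) ∉ v.asIdeal)
    (hSW : ∀ v : HeightOneSpectrum (𝓞 ℚ), ¬ W.HasGoodReductionAt v → v ∈ S₀)
    (hSA : ∀ v : HeightOneSpectrum (𝓞 ℚ), ¬ A.HasGoodReductionAt v → v ∈ S₀)
    {G GA : IwasawaAlgebra 2} {m m' : ℕ}
    (hG : iwasawaToPowerSeries 2 G =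
      PowerSeries.C ((2 : ℚ_[2]) ^ m * (ϖ : ℚ_[2])) * iwasawaToPowerSeries 2 (kobayashiL 1 Lplus Lminus))
    (hGA : iwasawaToPowerSeries 2 GA =
      PowerSeries.C ((2 : ℚ_[2]) ^ m' * (ϖA : ℚ_[2])) * iwasawaToPowerSeries 2 (kobayashiL 1 LplusA LminusA)) :
    ∃ u : ℤ_[2]ˣ, ∀ n : ℕ, Even n → ∃ q r : IwasawaAlgebra 2,
      PowerSeries.C (((2 : ℤ_[2]) ^ m' : ℤ_[2]) : ℚ_[2]) *
            (PowerSeries.C ((2 : ℚ_[2]) ^ m * (ϖ : ℚ_[2])) *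
              ((mazurTateElement f 2 n).map (algebraMap ℚ ℚ_[2]) : PowerSeries ℚ_[2]) *
              iwasawaToPowerSeries 2 (eulerFactorProductInv W 2 S₀)) -
          PowerSeries.C (((u : ℤ_[2]) * (2 : ℤ_[2]) ^ m : ℤ_[2]) : ℚ_[2]) *
            (PowerSeries.C ((2 : ℚ_[2]) ^ m' * (ϖA : ℚ_[2])) *
              ((mazurTateElement fA 2 n).map (algebraMap ℚ ℚ_[2]) : PowerSeries ℚ_[2]) *
              iwasawaToPowerSeries 2 (eulerFactorProductInv A 2 S₀)) =
        iwasawaToPowerSeries 2 (PowerSeries.C ((2 : ℤ_[2]) ^ (m + m' + 1)) * q + Sprung2017.toIwasawa 2 (cyclotomicOmega 2 n) * r) :=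
  mazurTateCongruence_of_plusLine W A (plusLineAtTwoLevel_of_charTwoLevel (plusLineCharTwo_of_fourFacts hES hSD hBz hSe)) hss hΔ
    hssA he f hf ϖ hPP fA hfA ϖA hPPA S₀ hS2 hSW hSA (symbolMu_of_flat W h2 hss ha hf hϖ hPP hflatW S₀ hS2)
    (symbolMu_of_flat A h2 hssA haA hfA hϖA hPPA hflatA S₀ hS2) hG hGA

/-- **(PR₂) at both curves ⇒ the crux's conclusion at `(W, A)`, behind FOUR print facts + the period fact.**
[cite: GreenbergVatsal2000, Thm. (1.4), §3 (13)] [cite: PollackWeston2011MT, Rem. 4.2.1] [cite: Buzzard2000LevelLoweringModTwo, Prop. 2.4] -/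
theorem mazurTateCongruence_of_fourFacts_undepletedMax
    (hES : eichlerShimura_depletedOptimalQuotient_periodLattice_of_dvd) (hSD : heckeSelfDual_torsionBy_J0)
    (hBz : buzzard2000_multiplicityOne_gamma0) (hSe : serre1972_supersingular_decompositionSubgroup_image)
    (h2 : realPeriodRat_eq_unit_mul_plusPeriod_two)
    (hss : GoodSS W 2) (ha : W.frobeniusTrace 2 = 0) (hΔ : W.Δ < 0) (hssA : GoodSS A 2) (haA : A.frobeniusTrace 2 = 0)
    (he : ∃ e : geomTorsion W (2 : ℤ) ≃+ geomTorsion A (2 : ℤ),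
      ∀ (σ : Field.absoluteGaloisGroup ℚ) (P : geomTorsion W (2 : ℤ)), e (σ • P) = σ • e P)
    [NeZero (W.conductorNorm ℤ)] (f : CuspForm (Gamma0 (W.conductorNorm ℤ)) 2) (hf : IsNewformOf W f) {ϖ : ℚ}
    (hϖ : (ϖ : ℝ) * W.realPeriodRat = plusPeriod f)
    {Lplus Lminus : IwasawaAlgebra 2} (hPP : IsPollackPair f 2 Lplus Lminus)
    [NeZero (A.conductorNorm ℤ)] (fA : CuspForm (Gamma0 (A.conductorNorm ℤ)) 2) (hfA : IsNewformOf A fA) {ϖA : ℚ}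
    (hϖA : (ϖA : ℝ) * A.realPeriodRat = plusPeriod fA)
    {LplusA LminusA : IwasawaAlgebra 2} (hPPA : IsPollackPair fA 2 LplusA LminusA)
    (S₀ : Finset (HeightOneSpectrum (𝓞 ℚ))) (hS2 : ∀ v ∈ S₀, ((2 : ℕ) : 𝓞 ℚ) ∉ v.asIdeal)
    (hSW : ∀ v : HeightOneSpectrum (𝓞 ℚ), ¬ W.HasGoodReductionAt v → v ∈ S₀)
    (hSA : ∀ v : HeightOneSpectrum (𝓞 ℚ), ¬ A.HasGoodReductionAt v → v ∈ S₀)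
    (hPRW : ∃ n₁ : ℕ, Even n₁ ∧ ∃ s : ZMod (2 ^ n₁), ∀ r : ℚ, ‖algebraMap ℚ (PadicAlgCl 2) (ratPlusSymbol f r)‖ ≤
      ‖algebraMap ℚ (PadicAlgCl 2) (ratPlusSymbol f ((((cyclotomicGenerator 2 : ZMod (2 ^ (n₁ + 2))) ^ s.val).val : ℚ) / (2 : ℚ) ^ (n₁ + 2)))‖)
    (hPRA : ∃ n₁ : ℕ, Even n₁ ∧ ∃ s : ZMod (2 ^ n₁), ∀ r : ℚ, ‖algebraMap ℚ (PadicAlgCl 2) (ratPlusSymbol fA r)‖ ≤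
      ‖algebraMap ℚ (PadicAlgCl 2) (ratPlusSymbol fA ((((cyclotomicGenerator 2 : ZMod (2 ^ (n₁ + 2))) ^ s.val).val : ℚ) / (2 : ℚ) ^ (n₁ + 2)))‖)
    {G GA : IwasawaAlgebra 2} {m m' : ℕ}
    (hG : iwasawaToPowerSeries 2 G =
      PowerSeries.C ((2 : ℚ_[2]) ^ m * (ϖ : ℚ_[2])) * iwasawaToPowerSeries 2 (kobayashiL 1 Lplus Lminus))
    (hGA : iwasawaToPowerSeries 2 GA =
      PowerSeries.C ((2 : ℚ_[2]) ^ m' * (ϖA : ℚ_[2])) * iwasawaToPowerSeries 2 (kobayashiL 1 LplusA LminusA)) :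
    ∃ u : ℤ_[2]ˣ, ∀ n : ℕ, Even n → ∃ q r : IwasawaAlgebra 2,
      PowerSeries.C (((2 : ℤ_[2]) ^ m' : ℤ_[2]) : ℚ_[2]) *
            (PowerSeries.C ((2 : ℚ_[2]) ^ m * (ϖ : ℚ_[2])) *
              ((mazurTateElement f 2 n).map (algebraMap ℚ ℚ_[2]) : PowerSeries ℚ_[2]) *
              iwasawaToPowerSeries 2 (eulerFactorProductInv W 2 S₀)) -
          PowerSeries.C (((u : ℤ_[2]) * (2 : ℤ_[2]) ^ m : ℤ_[2]) : ℚ_[2]) *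
            (PowerSeries.C ((2 : ℚ_[2]) ^ m' * (ϖA : ℚ_[2])) *
              ((mazurTateElement fA 2 n).map (algebraMap ℚ ℚ_[2]) : PowerSeries ℚ_[2]) *
              iwasawaToPowerSeries 2 (eulerFactorProductInv A 2 S₀)) =
        iwasawaToPowerSeries 2 (PowerSeries.C ((2 : ℤ_[2]) ^ (m + m' + 1)) * q + Sprung2017.toIwasawa 2 (cyclotomicOmega 2 n) * r) :=
  mazurTateCongruence_of_plusLine W A (plusLineAtTwoLevel_of_charTwoLevel (plusLineCharTwo_of_fourFacts hES hSD hBz hSe)) hss hΔ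
    hssA he f hf ϖ hPP fA hfA ϖA hPPA S₀ hS2 hSW hSA (symbolMu_of_undepletedMax W h2 hss ha hf hϖ S₀ hS2 hPRW)
    (symbolMu_of_undepletedMax A h2 hssA haA hfA hϖA S₀ hS2 hPRA) hG hGA

/-- **`CuspSpanEvenAtTwo` at the two conductors ⇒ the crux's conclusion at `(W, A)`, behind FOUR print facts + the period fact.**
[cite: Pollack2003, Conj. 6.3] [cite: GreenbergVatsal2000, Thm. (1.4), §3 (13)] [cite: Buzzard2000LevelLoweringModTwo, Prop. 2.4] -/
theorem mazurTateCongruence_of_fourFacts_cuspSpanAt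
    (hES : eichlerShimura_depletedOptimalQuotient_periodLattice_of_dvd) (hSD : heckeSelfDual_torsionBy_J0)
    (hBz : buzzard2000_multiplicityOne_gamma0) (hSe : serre1972_supersingular_decompositionSubgroup_image)
    (h2 : realPeriodRat_eq_unit_mul_plusPeriod_two)
    (hss : GoodSS W 2) (ha : W.frobeniusTrace 2 = 0) (hΔ : W.Δ < 0) (hssA : GoodSS A 2) (haA : A.frobeniusTrace 2 = 0)
    (he : ∃ e : geomTorsion W (2 : ℤ) ≃+ geomTorsion A (2 : ℤ),
      ∀ (σ : Field.absoluteGaloisGroup ℚ) (P : geomTorsion W (2 : ℤ)), e (σ • P) = σ • e P)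
    [NeZero (W.conductorNorm ℤ)] (f : CuspForm (Gamma0 (W.conductorNorm ℤ)) 2) (hf : IsNewformOf W f) {ϖ : ℚ}
    (hϖ : (ϖ : ℝ) * W.realPeriodRat = plusPeriod f)
    {Lplus Lminus : IwasawaAlgebra 2} (hPP : IsPollackPair f 2 Lplus Lminus)
    [NeZero (A.conductorNorm ℤ)] (fA : CuspForm (Gamma0 (A.conductorNorm ℤ)) 2) (hfA : IsNewformOf A fA) {ϖA : ℚ}
    (hϖA : (ϖA : ℝ) * A.realPeriodRat = plusPeriod fA)
    {LplusA LminusA : IwasawaAlgebra 2} (hPPA : IsPollackPair fA 2 LplusA LminusA)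
    (S₀ : Finset (HeightOneSpectrum (𝓞 ℚ))) (hS2 : ∀ v ∈ S₀, ((2 : ℕ) : 𝓞 ℚ) ∉ v.asIdeal)
    (hSW : ∀ v : HeightOneSpectrum (𝓞 ℚ), ¬ W.HasGoodReductionAt v → v ∈ S₀)
    (hSA : ∀ v : HeightOneSpectrum (𝓞 ℚ), ¬ A.HasGoodReductionAt v → v ∈ S₀)
    (hGW : SignedMuAtTwo.CuspSpanEvenAtTwo (W.conductorNorm ℤ)) (hGAc : SignedMuAtTwo.CuspSpanEvenAtTwo (A.conductorNorm ℤ))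
    {G GA : IwasawaAlgebra 2} {m m' : ℕ}
    (hG : iwasawaToPowerSeries 2 G =
      PowerSeries.C ((2 : ℚ_[2]) ^ m * (ϖ : ℚ_[2])) * iwasawaToPowerSeries 2 (kobayashiL 1 Lplus Lminus))
    (hGA : iwasawaToPowerSeries 2 GA =
      PowerSeries.C ((2 : ℚ_[2]) ^ m' * (ϖA : ℚ_[2])) * iwasawaToPowerSeries 2 (kobayashiL 1 LplusA LminusA)) :
    ∃ u : ℤ_[2]ˣ, ∀ n : ℕ, Even n → ∃ q r : IwasawaAlgebra 2,
      PowerSeries.C (((2 : ℤ_[2]) ^ m' : ℤ_[2]) : ℚ_[2]) *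
            (PowerSeries.C ((2 : ℚ_[2]) ^ m * (ϖ : ℚ_[2])) *
              ((mazurTateElement f 2 n).map (algebraMap ℚ ℚ_[2]) : PowerSeries ℚ_[2]) *
              iwasawaToPowerSeries 2 (eulerFactorProductInv W 2 S₀)) -
          PowerSeries.C (((u : ℤ_[2]) * (2 : ℤ_[2]) ^ m : ℤ_[2]) : ℚ_[2]) *
            (PowerSeries.C ((2 : ℚ_[2]) ^ m' * (ϖA : ℚ_[2])) *
              ((mazurTateElement fA 2 n).map (algebraMap ℚ ℚ_[2]) : PowerSeries ℚ_[2]) *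
              iwasawaToPowerSeries 2 (eulerFactorProductInv A 2 S₀)) =
        iwasawaToPowerSeries 2 (PowerSeries.C ((2 : ℤ_[2]) ^ (m + m' + 1)) * q + Sprung2017.toIwasawa 2 (cyclotomicOmega 2 n) * r) :=
  mazurTateCongruence_of_fourFacts_undepletedMax W A hES hSD hBz hSe h2 hss ha hΔ hssA haA he f hf hϖ hPP fA hfA hϖA hPPA S₀ hS2 hSW
    hSA (undepletedMax_of_cuspSpanEvenAtTwo hf hss ha hGW) (undepletedMax_of_cuspSpanEvenAtTwo hfA hssA haA hGAc) hG hGA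

/-- **Two unit L-values ⇒ the crux's conclusion at `(W, A)`, behind FOUR print facts + the period fact — no conjecture-grade input**
(the unit-zone road: `‖[0]⁺_f‖₂ = ‖[0]⁺_{f_A}‖₂ = 1`). [cite: Kurihara2002, Thm. 0.1 (unit L-value hypothesis; shape)]
[cite: GreenbergVatsal2000, Thm. (1.4), §3 (13)] [cite: Buzzard2000LevelLoweringModTwo, Prop. 2.4] -/
theorem mazurTateCongruence_of_fourFacts_unitLValues
    (hES : eichlerShimura_depletedOptimalQuotient_periodLattice_of_dvd) (hSD : heckeSelfDual_torsionBy_J0)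
    (hBz : buzzard2000_multiplicityOne_gamma0) (hSe : serre1972_supersingular_decompositionSubgroup_image)
    (h2 : realPeriodRat_eq_unit_mul_plusPeriod_two)
    (hss : GoodSS W 2) (ha : W.frobeniusTrace 2 = 0) (hΔ : W.Δ < 0) (hssA : GoodSS A 2) (haA : A.frobeniusTrace 2 = 0)
    (he : ∃ e : geomTorsion W (2 : ℤ) ≃+ geomTorsion A (2 : ℤ),
      ∀ (σ : Field.absoluteGaloisGroup ℚ) (P : geomTorsion W (2 : ℤ)), e (σ • P) = σ • e P)
    [NeZero (W.conductorNorm ℤ)] (f : CuspForm (Gamma0 (W.conductorNorm ℤ)) 2) (hf : IsNewformOf W f) {ϖ : ℚ}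
    (hϖ : (ϖ : ℝ) * W.realPeriodRat = plusPeriod f)
    {Lplus Lminus : IwasawaAlgebra 2} (hPP : IsPollackPair f 2 Lplus Lminus)
    [NeZero (A.conductorNorm ℤ)] (fA : CuspForm (Gamma0 (A.conductorNorm ℤ)) 2) (hfA : IsNewformOf A fA) {ϖA : ℚ}
    (hϖA : (ϖA : ℝ) * A.realPeriodRat = plusPeriod fA)
    {LplusA LminusA : IwasawaAlgebra 2} (hPPA : IsPollackPair fA 2 LplusA LminusA)
    (S₀ : Finset (HeightOneSpectrum (𝓞 ℚ))) (hS2 : ∀ v ∈ S₀, ((2 : ℕ) : 𝓞 ℚ) ∉ v.asIdeal)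
    (hSW : ∀ v : HeightOneSpectrum (𝓞 ℚ), ¬ W.HasGoodReductionAt v → v ∈ S₀)
    (hSA : ∀ v : HeightOneSpectrum (𝓞 ℚ), ¬ A.HasGoodReductionAt v → v ∈ S₀)
    (h0W : ‖algebraMap ℚ (PadicAlgCl 2) (ratPlusSymbol f 0)‖ = 1) (h0A : ‖algebraMap ℚ (PadicAlgCl 2) (ratPlusSymbol fA 0)‖ = 1)
    {G GA : IwasawaAlgebra 2} {m m' : ℕ}
    (hG : iwasawaToPowerSeries 2 G =
      PowerSeries.C ((2 : ℚ_[2]) ^ m * (ϖ : ℚ_[2])) * iwasawaToPowerSeries 2 (kobayashiL 1 Lplus Lminus))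
    (hGA : iwasawaToPowerSeries 2 GA =
      PowerSeries.C ((2 : ℚ_[2]) ^ m' * (ϖA : ℚ_[2])) * iwasawaToPowerSeries 2 (kobayashiL 1 LplusA LminusA)) :
    ∃ u : ℤ_[2]ˣ, ∀ n : ℕ, Even n → ∃ q r : IwasawaAlgebra 2,
      PowerSeries.C (((2 : ℤ_[2]) ^ m' : ℤ_[2]) : ℚ_[2]) *
            (PowerSeries.C ((2 : ℚ_[2]) ^ m * (ϖ : ℚ_[2])) *
              ((mazurTateElement f 2 n).map (algebraMap ℚ ℚ_[2]) : PowerSeries ℚ_[2]) *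
              iwasawaToPowerSeries 2 (eulerFactorProductInv W 2 S₀)) -
          PowerSeries.C (((u : ℤ_[2]) * (2 : ℤ_[2]) ^ m : ℤ_[2]) : ℚ_[2]) *
            (PowerSeries.C ((2 : ℚ_[2]) ^ m' * (ϖA : ℚ_[2])) *
              ((mazurTateElement fA 2 n).map (algebraMap ℚ ℚ_[2]) : PowerSeries ℚ_[2]) *
              iwasawaToPowerSeries 2 (eulerFactorProductInv A 2 S₀)) =
        iwasawaToPowerSeries 2 (PowerSeries.C ((2 : ℤ_[2]) ^ (m + m' + 1)) * q + Sprung2017.toIwasawa 2 (cyclotomicOmega 2 n) * r) :=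
  mazurTateCongruence_of_fourFacts_undepletedMax W A hES hSD hBz hSe h2 hss ha hΔ hssA haA he f hf hϖ hPP fA hfA hϖA hPPA S₀ hS2 hSW
    hSA (undepletedMax_layerZero_of_norm_ratPlusSymbol_zero_eq_one hf hss ha h0W)
    (undepletedMax_layerZero_of_norm_ratPlusSymbol_zero_eq_one hfA hssA haA h0A) hG hGA

end Pair

end Summit.BirchSwinnertonDyer.BirchSwinnertonDyer.Theorems.MazurTateCongruenceAtTwoR

end
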